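import Summits.QuantumFields.BalabanUV.T4Continuum.Support.NE7LandauLaplacianLetter
import Summits.QuantumFields.BalabanUV.T4Continuum.Support.NE7LatticeLandauEuler
import Summits.QuantumFields.BalabanUV.T4Continuum.Support.NE7FlatInteriorGradientModulusVec
import HarnessLib

/-!
# NE7LatticeLandauReg910 — [Balaban1985Variational] Thm 1 (9)₂, (10) AND (9)₃ FOR EVERY `β < 1`, IN THE EXACT LATTICE LANDAU GAUGE OF A PERIODIC SMALL-FIELD
# CONFIGURATION, FROM ITS SUP CURRENCY `a₀` AND ITS COVARIANT CURRENT `j` ALONE — the torus package: (9)₂ = (162)'s gradient currency, (10) = F5's Laplacian letter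
# at that gradient, (9)₃ = F3's interior `C^{1,β<1}` letter at that Laplacian; the ONE displayed analytic input is the sup letter `‖A₀‖ ≤ a₀` of the Landau
# representative (file F6 of gen 112's line «flat interior C^{1,log-Lip} potential theory + (10) ⟹ (9)_{β<1}»)

Cell `pub-balaban`, rung (B)+1 sub-cell t4, lineage `b2b-balaban-t4-ne7-p1` (CRUX PROVER NE7 #1 = OWNER of BINDER row NE7), generation 112.  Memo
`t4/b2b-balaban-t4-ne7-p1-g112/ROAD-G112.md` §3–§4.  BY NAME over: (161b) `NE7LatticeLandauEuler.exists_latticeLandauGauge` (co-owner t4-ne7-p2 g88: the exact lattice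
Landau gauge of a periodic configuration EXISTS — trace-link minimiser, Euler–Lagrange = lattice Landau condition at every site; the `sinh` form of the condition as in (162)
`NE7GradientCurrencyLatticeLandau`), (158b) `NE7GradientCurrencyLandauEL.gradient_currency_of_covDiv_EL`, F5
`NE7LandauLaplacianLetter.norm_laplacian_le_of_covDiv_EL`, F3 `NE7FlatInteriorGradientModulusVec.interior_gradient_holder_vec`.
THE THEOREM (**`landau_reg910`**, every `d ≥ 3`, every `U(n)`): `∃ C = C(d) ≥ 0` such that for every `P ≥ 1`, every `P`-periodic `U` with `SmallField U ε` (`ε ≥ 0`) and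
`‖covDiv 1 U ν x‖ ≤ j`, THERE IS a unitary `P`-periodic gauge `u` (`u 0 = 1`, the trace-link minimiser) whose representative satisfies the lattice Landau condition at every
site, and for every skew-Hermitian `A₀` with `U^{u} = e^{A₀}` and every sup currency `‖A₀‖ ≤ a₀`, writing `j_ε := j + dε((e^{2a₀} − 1) + 2ε(2 + ε))`:
 (10)  for every a priori gradient currency `G` (`‖A₀(y+e_τ)_κ − A₀(y)_κ‖ ≤ G`): `‖Δ A₀,ν(y)‖ ≤ j_ε + 4d(e^{4a₀} − 1)G + 2d(e^{a₀} − 1)G` at every site — LOG-FREE;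
 (9)₃  for every Laplacian bound `Λ` (`‖Δ A₀,ν‖ ≤ Λ`), every `m ≥ 1`, centre `x`, `0 ≤ β < 1`, `z, z′ ∈ cube x (m−1)` (`h := |z − z′|_∞`):
       `‖(A₀(z+e_μ)_κ − A₀(z)_κ) − (A₀(z′+e_μ)_κ − A₀(z′)_κ)‖ ≤ C(1 + (1−β)⁻¹)(Λ + a₀∕m²)(3m)^{1−β}h^β`;
 (9)₂  if `A₀` is `P`-periodic, `a₀ ≤ 1∕64` and `R ≥ 1` with `144·d·R·a₀ ≤ 1`: `‖A₀(y+e_τ)_κ − A₀(y)_κ‖ ≤ 4(d·a₀∕R + R·j_ε)` ((162)).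
READING (print's scaling at level `k`, `M = L^k`, `R = m = M`, `ε = r∕M²`, `j = c_j r∕M³` ✓ p814818, and the CRUX `a₀ = c₀r∕M`): `j_ε = O(r∕M³)`, (9)₂ `G = O(r∕M²)`, (10)
`Λ = O(r∕M³)`, (9)₃ `≤ C_β·r·h^β∕M^{2+β}` for all `h ≤ 2M − 2` — [Balaban1985Variational] (9)∕(10) at every `β < 1`, `k`-UNIFORM, in a GLOBAL torus Landau gauge; F7
`NE7AllMinimisersLandauReg910` docks it to the row's constrained minimisers with `a₀` displayed.
HONEST FRAMING (page 1): composition BY NAME of landed kernel theorems; the sup letter `a₀` of the Landau representative (and the existence of its skew logarithm `A₀`) is a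
HYPOTHESIS — on a torus it is obstructed in general by non-abelian zero modes (torus holonomies of the datum; ROAD-G112 §4), which is why print works on cubes `□` of size
`M(ε₁)`; nothing of Bałaban's asserted ([Balaban1985RegularSpaces] reaches its Landau gauge by a contraction); NOT NE3∕NE7 as spine nodes; spine 0∕9; finite T⁴ rung (B)+1 —
NOT infinite volume, NOT mass gap, NOT BetaPertH, NOT Clay (continuum YM on T⁴ ⇐ BetaPertH ∧ nine spine estimates).  0 def, 0 sorry.
-/

set_option autoImplicit false

open NormedSpace
open scoped BigOperators Matrix Matrix.Norms.L2Operator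
open Finset

namespace Summit.QuantumFields.BalabanUV.T4Continuum.NE7LatticeLandauReg910

open Literature.MathematicalPhysics.QuantumFieldTheory.Balaban1983to89
open B7Prop1Explicit B7Prop2Explicit MatrixNorms UnitaryModel
open B8Ineq132 (covDiv)
open T4AveragingDeficitWall (vary SmallField)
open T4AveragingDeficitWallBoundary (IsPeriodicCfg periodBox mem_periodBox)
open AveragingDeficitPeriodicCounting (IsPeriodicDir)
open BlockAveragePushDirSplit (flat)
open Beta.PoissonInterior (cube supNorm)
open NE7GradientCurrency (vary_flat_one_apply)
open NE7GradientCurrencyLandauEL (gradient_currency_of_covDiv_EL)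
open NE7LatticeLandauEuler (exists_latticeLandauGauge)
open NE7LandauLaplacianLetter (norm_laplacian_le_of_covDiv_EL)
open NE7FlatInteriorGradientModulusVec (interior_gradient_holder_vec)

noncomputable section

variable {d : ℕ} {n : Type*} [Fintype n] [DecidableEq n] [Nonempty n]

/-- **(9)₂, (10), (9)₃^{β<1} IN THE EXACT LATTICE LANDAU GAUGE, FROM `(a₀, j)`** — see the module docstring for the reading.  `d ≥ 3`; `C = C(d)` is the constant of F3's
interior `C^{1,β<1}` letter. [folklore] -/
theorem landau_reg910 (hd : 3 ≤ d) : ∃ C : ℝ, 0 ≤ C ∧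
    ∀ {P : ℕ}, 1 ≤ P → ∀ {U : Site d → Fin d → (Matrix n n ℂ)ˣ}, IsPeriodicCfg U (P : ℤ) →
    ∀ {ε j : ℝ}, 0 ≤ ε → SmallField U ε → (∀ (ν : Fin d) (x : Site d), ‖covDiv 1 U ν x‖ ≤ j) →
    ∃ u : Site d → (Matrix n n ℂ)ˣ, (∀ x, u x ∈ unitaryUnits (Matrix n n ℂ)) ∧ (∀ (x : Site d) (τ : Fin d), u (x + (P : ℤ) • e τ) = u x) ∧
      u 0 = 1 ∧
      (∀ v : Site d → (Matrix n n ℂ)ˣ, (∀ x, v x ∈ unitaryUnits (Matrix n n ℂ)) → (∀ (x : Site d) (τ : Fin d), v (x + (P : ℤ) • e τ) = v x) →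
        v 0 = 1 →
        ∑ x ∈ periodBox (d := d) P, ∑ κ : Fin d, (1 - nReTr ((gaugeAct u U x κ : (Matrix n n ℂ)ˣ) : Matrix n n ℂ))
          ≤ ∑ x ∈ periodBox (d := d) P, ∑ κ : Fin d, (1 - nReTr ((gaugeAct v U x κ : (Matrix n n ℂ)ˣ) : Matrix n n ℂ))) ∧
      (∀ z : Site d, ∑ κ : Fin d, ((((gaugeAct u U z κ : (Matrix n n ℂ)ˣ) : Matrix n n ℂ) - ((gaugeAct u U z κ : (Matrix n n ℂ)ˣ) : Matrix n n ℂ)ᴴ)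
        - (((gaugeAct u U (z - e κ) κ : (Matrix n n ℂ)ˣ) : Matrix n n ℂ) - ((gaugeAct u U (z - e κ) κ : (Matrix n n ℂ)ˣ) : Matrix n n ℂ)ᴴ)) = 0) ∧
      ∀ (A₀ : Site d → Fin d → Matrix n n ℂ), gaugeAct u U = vary (flat (d := d) (n := n)) A₀ 1 →
        (∀ (y : Site d) (κ : Fin d), (A₀ y κ)ᴴ = -A₀ y κ) →
        ∀ (a₀ : ℝ), (∀ (y : Site d) (κ : Fin d), ‖A₀ y κ‖ ≤ a₀) →
        -- (10): the Laplacian from any a priori gradient currency `G`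
        (∀ (G : ℝ), (∀ (x : Site d) (κ τ : Fin d), ‖A₀ (x + e τ) κ - A₀ x κ‖ ≤ G) →
          ∀ (y : Site d) (ν : Fin d), ‖∑ i, ((A₀ (y + e i) ν - A₀ y ν) - (A₀ y ν - A₀ (y - e i) ν))‖
            ≤ (j + d * (ε * ((Real.exp (2 * a₀) - 1) + 2 * ε * (2 + ε)))) + 4 * d * (Real.exp (4 * a₀) - 1) * G
              + 2 * d * (Real.exp a₀ - 1) * G) ∧
        -- (9)₃: the Hölder modulus of the gradient from any Laplacian bound `Λ`, every `β < 1`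
        (∀ (Λ : ℝ), (∀ (y : Site d) (ν : Fin d), ‖∑ i, ((A₀ (y + e i) ν - A₀ y ν) - (A₀ y ν - A₀ (y - e i) ν))‖ ≤ Λ) →
          ∀ (m : ℕ), 1 ≤ m → ∀ (x : Site d) (β : ℝ), 0 ≤ β → β < 1 →
          ∀ (z z' : Site d), z ∈ cube x (m - 1) → z' ∈ cube x (m - 1) → ∀ μ κ : Fin d,
            ‖(A₀ (z + e μ) κ - A₀ z κ) - (A₀ (z' + e μ) κ - A₀ z' κ)‖
              ≤ C * (1 + (1 - β)⁻¹) * (Λ + a₀ / (m : ℝ) ^ 2) * (3 * m : ℝ) ^ (1 - β) * (supNorm (z - z') : ℝ) ^ β) ∧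
        -- (9)₂: the gradient currency on the torus ((162))
        (IsPeriodicDir A₀ (P : ℤ) → a₀ ≤ 1 / 64 → ∀ (R : ℕ), 1 ≤ R → 144 * (d : ℝ) * R * a₀ ≤ 1 →
          ∀ (y : Site d) (κ τ : Fin d),
            ‖A₀ (y + e τ) κ - A₀ y κ‖ ≤ 4 * ((d : ℝ) * a₀ / R + R * (j + d * (ε * ((Real.exp (2 * a₀) - 1) + 2 * ε * (2 + ε)))))) := by
  obtain ⟨C, hC, hhol⟩ := interior_gradient_holder_vec (d := d) (E := Matrix n n ℂ) hd
  have hd1 : 1 ≤ d := by omega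
  refine ⟨C, hC, fun {P} hP {U} hUP {ε} {j} hε0 hUε hcov => ?_⟩
  obtain ⟨u, hu, huP, hu0, hmin, hEL⟩ := exists_latticeLandauGauge (d := d) (n := n) hP hUP
  refine ⟨u, hu, huP, hu0, hmin, hEL, ?_⟩
  intro A₀ hgauge hskew a₀ ha₀
  have hW : ∀ (z : Site d) (μ : Fin d), ((gaugeAct u U z μ : (Matrix n n ℂ)ˣ) : Matrix n n ℂ) = exp (A₀ z μ) := fun z μ => by
    rw [hgauge, vary_flat_one_apply, val_expUnit]
  have hH : ∀ (y : Site d) (κ : Fin d), (exp (A₀ y κ))ᴴ = exp (-A₀ y κ) := fun y κ => by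
    rw [← Matrix.exp_conjTranspose, hskew]
  -- the Landau condition on `W − Wᴴ = e^{A₀} − e^{−A₀}` is the vanishing of the `sinh`-reaction ((162)'s reading)
  have key : ∀ z : Site d,
      ∑ μ : Fin d, (((2 : ℂ)⁻¹ • (exp (A₀ z μ) - exp (-A₀ z μ))) - ((2 : ℂ)⁻¹ • (exp (A₀ (z - e μ) μ) - exp (-A₀ (z - e μ) μ)))) = 0 := by
    intro z
    have h := hEL z
    simp only [hW, hH] at h
    simp_rw [← smul_sub]
    rw [← Finset.smul_sum, h, smul_zero]
  have hEL' : ∀ (x : Site d) (ν : Fin d),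
      ‖∑ μ, (((2 : ℂ)⁻¹ • (exp (A₀ (x + e ν) μ) - exp (-A₀ (x + e ν) μ)))
                - ((2 : ℂ)⁻¹ • (exp (A₀ (x + e ν - e μ) μ) - exp (-A₀ (x + e ν - e μ) μ))))
          - ∑ μ, (((2 : ℂ)⁻¹ • (exp (A₀ x μ) - exp (-A₀ x μ))) - ((2 : ℂ)⁻¹ • (exp (A₀ (x - e μ) μ) - exp (-A₀ (x - e μ) μ))))‖
        ≤ 0 := fun x ν => by
    rw [key (x + e ν), key x, sub_self, norm_zero]
  refine ⟨fun G hG y ν => ?_, fun Λ hΛ m hm x β hβ0 hβ1 z z' hz hz' μ κ => ?_, fun hA₀P ha₀s R hR hreg y κ τ => ?_⟩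
  · -- (10)
    have h := norm_laplacian_le_of_covDiv_EL hε0 hUε hcov hu hgauge ha₀ hG hEL' y ν
    simpa only [add_zero] using h
  · -- (9)₃
    exact hhol m hm (fun w => A₀ w κ) x Λ a₀ (fun y _ => hΛ y κ) (fun y _ => ha₀ y κ) β hβ0 hβ1 z z' hz hz' μ
  · -- (9)₂
    have h := gradient_currency_of_covDiv_EL hd1 hε0 hUε hcov hu hgauge hP hA₀P ha₀ ha₀s hEL' hR hreg y κ τ
    simpa only [add_zero] using h

end

end Summit.QuantumFields.BalabanUV.T4Continuum.NE7LatticeLandauReg910
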